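import Summits.Schanuel.Schanuel.Theorems.ZilberEacInvariantDirectionGeneric
import Summits.Schanuel.Schanuel.Theorems.ZilberEacTransversalLimits
import Summits.Schanuel.Schanuel.Theorems.ZilberEacInvariantDirectionExistence
import HarnessLib

/-!
# Density in the INVARIANT-DIRECTION regime: degenerate balance directions (O51 (b))

Zilber's Exponential-Algebraic Closedness, case ladder (host summit Schanuel, cell `pub-schanuel`,
seat 2, gen 11).  Let `q ∈ ℤ^{s+1}` and let the graph base `x_{s+1} = g(x)` be INVARIANT under `q`,
`g(x + z q) = g(x)` (`z ∈ ℂ`), `deg g ≥ 1`; targets `Aⱼ ∈ ℂ[x₀..x_s]` with leading forms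
non-vanishing at `2πi q` and degrees `dⱼ = λ qⱼ ≥ 1`; fibre polynomials `fⱼ ∈ ℂ[u]` ARBITRARY
(zero allowed).  The `(s+2)`-fold

  `W = polyFibredGraph g A f = {x_{s+1} = g(x), yⱼ = Aⱼ(x) + y_{s+1} fⱼ(y_{s+1})} ⊆ ℂ^{s+2} × ℂ^{s+2}`

has exponential points = solutions of `e^{xⱼ} = Aⱼ(x) + e^{g(x)} fⱼ(e^{g(x)})`.

**THEOREM (`unprojectedDense_polyFibredGraph_invariantDirection`).**  If in addition some lattice
direction `ℓ₀` (all `ℓ₀ⱼ ≠ 0`) has `Re g_D(2πi ℓ₀) ≠ 0`, then `I(W ∩ Γ_exp) = I(W)`.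

Proof.  EXISTENCE (`ZilberEacInvariantDirectionExistence`): for every label `p ∈ ℤ^{s+1}` solutions
`x(m) = r(m) + (2πi m + λ log m) q`, `r(m) → r_p = 2πi p + log a`, power coordinate
`e^{g(x(m))} = e^{g(r(m))} → e^{g(r_p)}` (bounded!).  ELIMINATION: THEOREM L
(`ZilberEacTransversalLimits`) reduces density to the genericity of the limit family
`U = {(e^{g(r_p)}, r_p) : p ∈ ℤ^{s+1}}` (`unprojectedDense_polyFibredGraph_invariantDirection_of_generic`),
and `ZilberEacInvariantDirectionGeneric.invariantDirection_limits_generic` proves it with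
THEOREM K₀′ (`Re g_D(2πiℓ₀) > 0`: along `p = nℓ` the value `e^{g(r_p)}` explodes) or THEOREM J₀′
(`Re g_D(2πiℓ₀) < 0`: it decays); the rotation variant (real hyperplanes) is
`ZilberEacInvariantDirectionRotation`.

**Flagship (`negSqDiff_member_dense`).**  `{x₂ = -(x₀ - x₁)², y₀ = x₀ + y₂, y₁ = x₁ + y₂} ⊆ ℂ³ × ℂ³`
(`e^z = z + e^{-(z-w)²}`, `e^w = w + e^{-(z-w)²}`): `Re g_D(2πiq) = 4π²(q₀ - q₁)² ≥ 0` (no negative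
ray, not oscillatory), `g_D(1,1) = 0` (degenerate balance direction) — the example named OPEN in
O51 (b) after gen 10 — is a certified member of `EC(3,2)`, not linearly split, with ZARISKI DENSE
exponential points.

HONEST FRAMING: explicit families inside an OPEN cell (the base has the rational period `q`, so these
families lie in seat 1's periodic sub-cell, where EXISTENCE is cheap — here `z = w = 0` solves the
flagship — and the content is the DENSITY `I(W ∩ Γ_exp) = I(W)`, Mantova–Masser's typed question);
`EC(3,2)` OPEN; NOT Schanuel's conjecture; EAC ⇏ SC.
-/

noncomputable section

open Complex MvPolynomial Filter Topology
open Literature.NumberTheory.Transcendental Literature.ModelTheory.Zilber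
  Literature.ModelTheory.ExponentialFields

set_option linter.dupNamespace false

namespace Summit.Schanuel.Schanuel.Theorems

/-! ## Part A. The density theorem -/

section Density

variable {s : ℕ}

/-- **Density in the invariant-direction regime from a GENERIC limit family.**  The assembly of
EXISTENCE (`exists_solutions_invariantDirection`) and THEOREM L: if no nonzero polynomial vanishes
at all limits `(e^{g(r_p)}, r_p)`, `r_p = 2πi p + log a` (`p ∈ ℤ^{s+1}`), then
`I(W ∩ Γ_exp) = I(W)`.  (The genericity is supplied by `invariantDirection_limits_generic` below, or
by the rotation variant of `ZilberEacInvariantDirectionRotation`.) (new)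
[cite: MantovaMasser2023, §1 p.5 (the open case dim π(V) = 2 in ℂ³×ℂˣ³)] -/
theorem unprojectedDense_polyFibredGraph_invariantDirection_of_generic
    (g : MvPolynomial (Fin (s + 1)) ℂ) (q : Fin (s + 1) → ℤ)
    (hper : ∀ (x : Fin (s + 1) → ℂ) (z : ℂ), eval (x + z • fun j => (q j : ℂ)) g = eval x g)
    (A : Fin (s + 1) → MvPolynomial (Fin (s + 1)) ℂ)
    (hA : ∀ j, eval (fun i => 2 * Real.pi * I * (q i : ℂ))
      (homogeneousComponent (A j).totalDegree (A j)) ≠ 0)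
    (lam : ℝ) (hlam : ∀ j, ((A j).totalDegree : ℝ) = lam * (q j : ℝ))
    (hdeg : ∀ j, 0 < (A j).totalDegree) (f : Fin (s + 1) → Polynomial ℂ)
    (hgen : ∀ G : MvPolynomial (Fin (s + 2)) ℂ, G ≠ 0 → ∃ p : Fin (s + 1) → ℤ,
      eval (Fin.cons (exp (eval (fun j => 2 * Real.pi * I * (p j : ℂ) +
          log (eval (fun i => 2 * Real.pi * I * (q i : ℂ))
            (homogeneousComponent (A j).totalDegree (A j)))) g))
        (fun j => 2 * Real.pi * I * (p j : ℂ) +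
          log (eval (fun i => 2 * Real.pi * I * (q i : ℂ))
            (homogeneousComponent (A j).totalDegree (A j)))) : Fin (s + 2) → ℂ) G ≠ 0) :
    UnprojectedDense (polyFibredGraph g A (fun j => (f j).toMvPolynomial 0)) := by
  classical
  set L : Fin (s + 1) → ℂ := fun j => log (eval (fun i => 2 * Real.pi * I * (q i : ℂ))
    (homogeneousComponent (A j).totalDegree (A j))) with hL
  set rp : (Fin (s + 1) → ℤ) → Fin (s + 1) → ℂ := fun p j => 2 * Real.pi * I * (p j : ℂ) + L j
    with hrp
  refine unprojectedDense_of_transversal_limits (t := s + 1)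
    (isIrreducibleClosed_polyFibredGraph g A _) (by rw [zariskiDim_polyFibredGraph])
    (fun i => Sum.inl (Fin.castSucc i)) (Sum.inr (Fin.last (s + 1))) (fun j => (q j : ℂ))
    (U := {u | ∃ p : Fin (s + 1) → ℤ, u = Fin.cons (exp (eval (rp p) g)) (rp p)})
    (fun G hG => ?_) ?_
  · obtain ⟨p, hp⟩ := hgen G hG
    exact ⟨_, ⟨p, rfl⟩, hp⟩
  rintro u ⟨p, rfl⟩
  obtain ⟨x, r, hsol, hxr, hgr, hr, hy⟩ :=
    exists_solutions_invariantDirection g q hper A hA lam hlam hdeg f p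
  set P : ℕ → Fin (s + 2) ⊕ Fin (s + 2) → ℂ := fun m =>
    pgParam g A (fun j => (f j).toMvPolynomial 0) (x m) (exp (eval (x m) g)) with hP
  refine ⟨P, r, fun m => 2 * Real.pi * I * (m : ℂ) + (lam : ℂ) * log (m : ℂ), ?_, ?_, ?_, ?_, hy⟩
  · filter_upwards [hsol] with m hm
    refine ⟨pgParam_mem g A _ _ _, pgParam_mem_expGraph_of_solution g A _ fun j => ?_⟩
    rw [hm j, MvPolynomial.eval_toMvPolynomial, Fin.cons_zero]
  · filter_upwards with m
    have hcoord : (fun i => P m (Sum.inl (Fin.castSucc i))) = x m := by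
      funext i; simp [hP]
    rw [hcoord, hxr m]
  · have hβ : (fun m => P m (Sum.inr (Fin.last (s + 1)))) = fun m => exp (eval (r m) g) := by
      funext m
      simp only [hP, pgParam_inr, pMulParam_last]
      rw [hgr m]
    rw [hβ, Fin.cons_zero]
    exact (Complex.continuous_exp.tendsto _).comp
      (((MvPolynomial.continuous_eval g).tendsto _).comp hr)
  · rw [Fin.tail_cons]
    exact hr

/-- **THEOREM (density in the invariant-direction regime).**  See the module docstring: `g`
invariant under `q`, `deg g ≥ 1`, leading forms of the `Aⱼ` non-vanishing at `2πi q`, degrees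
`dⱼ = λ qⱼ ≥ 1`, fibre polynomials arbitrary, and a lattice direction `ℓ₀` (all `ℓ₀ⱼ ≠ 0`) with
`Re g_D(2πi ℓ₀) ≠ 0` ⟹ `I(W ∩ Γ_exp) = I(W)`. (new)
[cite: MantovaMasser2023, §1 p.5 (the open case dim π(V) = 2 in ℂ³×ℂˣ³)] -/
theorem unprojectedDense_polyFibredGraph_invariantDirection (g : MvPolynomial (Fin (s + 1)) ℂ)
    (hD : 0 < g.totalDegree) (q : Fin (s + 1) → ℤ)
    (hper : ∀ (x : Fin (s + 1) → ℂ) (z : ℂ), eval (x + z • fun j => (q j : ℂ)) g = eval x g)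
    (A : Fin (s + 1) → MvPolynomial (Fin (s + 1)) ℂ)
    (hA : ∀ j, eval (fun i => 2 * Real.pi * I * (q i : ℂ))
      (homogeneousComponent (A j).totalDegree (A j)) ≠ 0)
    (lam : ℝ) (hlam : ∀ j, ((A j).totalDegree : ℝ) = lam * (q j : ℝ))
    (hdeg : ∀ j, 0 < (A j).totalDegree) (f : Fin (s + 1) → Polynomial ℂ)
    (ℓ₀ : Fin (s + 1) → ℤ)
    (hℓ₀ : (eval (fun j => 2 * Real.pi * I * (ℓ₀ j : ℂ)) (homogeneousComponent g.totalDegree g)).re ≠ 0)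
    (hℓ₀0 : ∀ j, ℓ₀ j ≠ 0) :
    UnprojectedDense (polyFibredGraph g A (fun j => (f j).toMvPolynomial 0)) :=
  unprojectedDense_polyFibredGraph_invariantDirection_of_generic g q hper A hA lam hlam hdeg f
    (invariantDirection_limits_generic g hD ℓ₀ hℓ₀ hℓ₀0 _)

/-- **Certified members with dense exponential points.**  `A` dominant (`aeval A` injective),
`deg g ≥ 2`, and the hypotheses of the density theorem: all seven hypotheses of
`ECCell (s+2) (s+1)`, not linearly split, `W ∩ Γ_exp ≠ ∅`, `I(W ∩ Γ_exp) = I(W)`. (new)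
[cite: MantovaMasser2023, §1 p.5 (the open case dim π(V) = 2 in ℂ³×ℂˣ³)] -/
theorem polyFibredGraph_invariantDirection_member_dense (g : MvPolynomial (Fin (s + 1)) ℂ)
    (hg : 2 ≤ g.totalDegree) (q : Fin (s + 1) → ℤ)
    (hper : ∀ (x : Fin (s + 1) → ℂ) (z : ℂ), eval (x + z • fun j => (q j : ℂ)) g = eval x g)
    (A : Fin (s + 1) → MvPolynomial (Fin (s + 1)) ℂ)
    (hAinj : Function.Injective
      (aeval A : MvPolynomial (Fin (s + 1)) ℂ →ₐ[ℂ] MvPolynomial (Fin (s + 1)) ℂ))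
    (hA : ∀ j, eval (fun i => 2 * Real.pi * I * (q i : ℂ))
      (homogeneousComponent (A j).totalDegree (A j)) ≠ 0)
    (lam : ℝ) (hlam : ∀ j, ((A j).totalDegree : ℝ) = lam * (q j : ℝ))
    (hdeg : ∀ j, 0 < (A j).totalDegree) (f : Fin (s + 1) → Polynomial ℂ)
    (ℓ₀ : Fin (s + 1) → ℤ)
    (hℓ₀ : (eval (fun j => 2 * Real.pi * I * (ℓ₀ j : ℂ)) (homogeneousComponent g.totalDegree g)).re ≠ 0)
    (hℓ₀0 : ∀ j, ℓ₀ j ≠ 0) :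
    (IsIrreducibleClosed ℂ (polyFibredGraph g A (fun j => (f j).toMvPolynomial 0)) ∧
      (polyFibredGraph g A (fun j => (f j).toMvPolynomial 0) ∩ torusLocus ℂ (s + 2)).Nonempty ∧
      IsRotund ℂ (s + 2) (polyFibredGraph g A (fun j => (f j).toMvPolynomial 0) ∩
        torusLocus ℂ (s + 2)) ∧
      IsAddFree ℂ (s + 2) (polyFibredGraph g A (fun j => (f j).toMvPolynomial 0) ∩
        torusLocus ℂ (s + 2)) ∧
      IsMulFree ℂ (s + 2) (polyFibredGraph g A (fun j => (f j).toMvPolynomial 0) ∩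
        torusLocus ℂ (s + 2)) ∧
      zariskiDim ℂ (polyFibredGraph g A (fun j => (f j).toMvPolynomial 0)) = (s + 2 : ℕ) ∧
      addProjDim ℂ (s + 2) (polyFibredGraph g A (fun j => (f j).toMvPolynomial 0)) = (s + 1 : ℕ)) ∧
    ¬ IsLinearSplit ℂ (s + 2) (polyFibredGraph g A (fun j => (f j).toMvPolynomial 0)) ∧
    (polyFibredGraph g A (fun j => (f j).toMvPolynomial 0) ∩ expGraph ℂ (s + 2)).Nonempty ∧
    UnprojectedDense (polyFibredGraph g A (fun j => (f j).toMvPolynomial 0)) := by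
  have hcell := ecCell_hypotheses_polyFibredGraph g A (fun j => (f j).toMvPolynomial 0) hAinj hg
  have hdense := unprojectedDense_polyFibredGraph_invariantDirection g (by omega) q hper A hA lam
    hlam hdeg f ℓ₀ hℓ₀ hℓ₀0
  refine ⟨hcell, not_isLinearSplit_polyFibredGraph g A _ (Nat.succ_pos s) hAinj, ?_, hdense⟩
  obtain ⟨w, hw, -⟩ := hcell.2.1
  exact inter_expGraph_nonempty_of_vanishingIdeal_eq ⟨w, hw⟩ hdense

end Density

/-! ## Part B. The flagship member of `EC(3,2)` with a degenerate balance direction -/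

section Example

/-- Data of the base `g = -(X₀ - X₁)²`: degree `2`; invariant under `q = (1,1)`;
`Re g_D(2πi(1,-1)) = 16π² ≠ 0`; `Re g_D(2πiq) = 4π²(q₀ - q₁)² ≥ 0` for EVERY lattice direction (no
negative ray) and `g_D(1,1) = 0` (degenerate balance direction for equal fibre degrees). [folklore] -/
theorem negSqDiff_data :
    (-(X 0 - X 1) ^ 2 : MvPolynomial (Fin 2) ℂ).totalDegree = 2 ∧
    (∀ (x : Fin 2 → ℂ) (z : ℂ), eval (x + z • fun j => ((![1, 1] : Fin 2 → ℤ) j : ℂ))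
      (-(X 0 - X 1) ^ 2 : MvPolynomial (Fin 2) ℂ) = eval x (-(X 0 - X 1) ^ 2 : MvPolynomial (Fin 2) ℂ)) ∧
    (eval (fun j => 2 * Real.pi * I * ((![1, -1] : Fin 2 → ℤ) j : ℂ)) (homogeneousComponent
      (-(X 0 - X 1) ^ 2 : MvPolynomial (Fin 2) ℂ).totalDegree
      (-(X 0 - X 1) ^ 2 : MvPolynomial (Fin 2) ℂ))).re ≠ 0 ∧
    (∀ p : Fin 2 → ℤ, 0 ≤ (eval (fun j => 2 * Real.pi * I * (p j : ℂ)) (homogeneousComponent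
      (-(X 0 - X 1) ^ 2 : MvPolynomial (Fin 2) ℂ).totalDegree
      (-(X 0 - X 1) ^ 2 : MvPolynomial (Fin 2) ℂ))).re) ∧
    eval (fun _ => (1 : ℂ)) (homogeneousComponent
      (-(X 0 - X 1) ^ 2 : MvPolynomial (Fin 2) ℂ).totalDegree
      (-(X 0 - X 1) ^ 2 : MvPolynomial (Fin 2) ℂ)) = 0 := by
  set g : MvPolynomial (Fin 2) ℂ := -(X 0 - X 1) ^ 2 with hg
  have hhom : g.IsHomogeneous 2 := ((isHomogeneous_X ℂ 0).sub (isHomogeneous_X ℂ 1)).pow 2 |>.neg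
  have heval : ∀ x : Fin 2 → ℂ, eval x g = -(x 0 - x 1) ^ 2 := fun x => by
    simp [hg, map_sub, map_pow, eval_X]
  have hg0 : g ≠ 0 := by
    intro h
    have := heval ![1, 0]
    rw [h, map_zero] at this
    norm_num at this
  have hdeg : g.totalDegree = 2 := hhom.totalDegree hg0
  refine ⟨hdeg, fun x z => ?_, ?_, fun p => ?_, ?_⟩
  · rw [heval, heval]
    simp only [Pi.add_apply, Pi.smul_apply, smul_eq_mul, Matrix.cons_val_zero, Matrix.cons_val_one]
    push_cast
    ring
  · rw [hdeg, homogeneousComponent_eq_self hhom, heval]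
    simp only [Matrix.cons_val_zero, Matrix.cons_val_one]
    have h1 : -((2 * (Real.pi : ℂ) * I * ((1 : ℤ) : ℂ)) - 2 * Real.pi * I * ((-1 : ℤ) : ℂ)) ^ 2 =
        ((16 * Real.pi ^ 2 : ℝ) : ℂ) := by
      push_cast
      ring_nf
      rw [Complex.I_sq]
      ring
    rw [h1, Complex.ofReal_re]
    positivity
  · rw [hdeg, homogeneousComponent_eq_self hhom, heval]
    have h1 : -((2 * (Real.pi : ℂ) * I * (p 0 : ℂ)) - 2 * Real.pi * I * (p 1 : ℂ)) ^ 2 =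
        ((4 * Real.pi ^ 2 * ((p 0 : ℝ) - (p 1 : ℝ)) ^ 2 : ℝ) : ℂ) := by
      push_cast
      ring_nf
      rw [Complex.I_sq]
      ring
    rw [h1, Complex.ofReal_re]
    positivity
  · rw [hdeg, homogeneousComponent_eq_self hhom, heval]
    norm_num

/-- **The flagship member of `EC(3,2)` with a DEGENERATE balance direction**:
`W = {x₂ = -(x₀ - x₁)², y₀ = x₀ + y₂, y₁ = x₁ + y₂} ⊆ ℂ³ × ℂ³` (`e^z = z + e^{-(z-w)²}`,
`e^w = w + e^{-(z-w)²}`): all seven hypotheses of `ECCell 3 2`, not linearly split,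
`W ∩ Γ_exp ≠ ∅` AND `I(W ∩ Γ_exp) = I(W)` — the base has no negative and no oscillatory ray and
the balance direction `(1,1)` is degenerate (`g_D(1,1) = 0`), so the variety is outside every
earlier theorem of the cell (O51 (b)). (new)
[cite: MantovaMasser2023, §1 p.5 (the open case dim π(V) = 2 in ℂ³×ℂˣ³)] -/
theorem negSqDiff_member_dense :
    (IsIrreducibleClosed ℂ (polyFibredGraph (-(X 0 - X 1) ^ 2 : MvPolynomial (Fin 2) ℂ)
        (fun j => X j) (fun _ => 1)) ∧
      (polyFibredGraph (-(X 0 - X 1) ^ 2 : MvPolynomial (Fin 2) ℂ) (fun j => X j) (fun _ => 1) ∩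
        torusLocus ℂ 3).Nonempty ∧
      IsRotund ℂ 3 (polyFibredGraph (-(X 0 - X 1) ^ 2 : MvPolynomial (Fin 2) ℂ) (fun j => X j)
        (fun _ => 1) ∩ torusLocus ℂ 3) ∧
      IsAddFree ℂ 3 (polyFibredGraph (-(X 0 - X 1) ^ 2 : MvPolynomial (Fin 2) ℂ) (fun j => X j)
        (fun _ => 1) ∩ torusLocus ℂ 3) ∧
      IsMulFree ℂ 3 (polyFibredGraph (-(X 0 - X 1) ^ 2 : MvPolynomial (Fin 2) ℂ) (fun j => X j)
        (fun _ => 1) ∩ torusLocus ℂ 3) ∧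
      zariskiDim ℂ (polyFibredGraph (-(X 0 - X 1) ^ 2 : MvPolynomial (Fin 2) ℂ) (fun j => X j)
        (fun _ => 1)) = (3 : ℕ) ∧
      addProjDim ℂ 3 (polyFibredGraph (-(X 0 - X 1) ^ 2 : MvPolynomial (Fin 2) ℂ) (fun j => X j)
        (fun _ => 1)) = (2 : ℕ)) ∧
    ¬ IsLinearSplit ℂ 3 (polyFibredGraph (-(X 0 - X 1) ^ 2 : MvPolynomial (Fin 2) ℂ)
        (fun j => X j) (fun _ => 1)) ∧
    (polyFibredGraph (-(X 0 - X 1) ^ 2 : MvPolynomial (Fin 2) ℂ) (fun j => X j) (fun _ => 1) ∩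
        expGraph ℂ 3).Nonempty ∧
    UnprojectedDense (polyFibredGraph (-(X 0 - X 1) ^ 2 : MvPolynomial (Fin 2) ℂ)
        (fun j => X j) (fun _ => 1)) := by
  obtain ⟨hdeg, hper, hℓ₀, -, -⟩ := negSqDiff_data
  have hAinj : Function.Injective (aeval (fun j : Fin 2 => (X j : MvPolynomial (Fin 2) ℂ)) :
      MvPolynomial (Fin 2) ℂ →ₐ[ℂ] MvPolynomial (Fin 2) ℂ) := by
    rw [aeval_X_left]; exact fun _ _ h => h
  have hF : (fun _ : Fin 2 => (1 : MvPolynomial (Fin 3) ℂ)) =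
      fun j : Fin 2 => ((fun _ : Fin 2 => (1 : Polynomial ℂ)) j).toMvPolynomial 0 := by
    funext j; simp
  have hlead : ∀ j : Fin 2, homogeneousComponent (X j : MvPolynomial (Fin 2) ℂ).totalDegree
      (X j : MvPolynomial (Fin 2) ℂ) = X j := fun j => by
    rw [totalDegree_X, homogeneousComponent_eq_self (isHomogeneous_X ℂ j)]
  have hA : ∀ j : Fin 2, eval (fun i => 2 * Real.pi * I * ((![1, 1] : Fin 2 → ℤ) i : ℂ))
      (homogeneousComponent (X j : MvPolynomial (Fin 2) ℂ).totalDegree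
        (X j : MvPolynomial (Fin 2) ℂ)) ≠ 0 := by
    intro j
    rw [hlead j, eval_X]
    fin_cases j <;> simp [Real.pi_ne_zero, Complex.I_ne_zero]
  have hlam : ∀ j : Fin 2, ((X j : MvPolynomial (Fin 2) ℂ).totalDegree : ℝ) =
      (1 : ℝ) * (((![1, 1] : Fin 2 → ℤ) j : ℤ) : ℝ) := by
    intro j
    rw [totalDegree_X]
    fin_cases j <;> simp
  have hdeg1 : ∀ j : Fin 2, 0 < (X j : MvPolynomial (Fin 2) ℂ).totalDegree := fun j => by
    rw [totalDegree_X]; exact Nat.one_pos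
  rw [hF]
  exact polyFibredGraph_invariantDirection_member_dense _ (by rw [hdeg]) ![1, 1] hper _ hAinj hA 1
    hlam hdeg1 _ ![1, -1] hℓ₀ (fun j => by fin_cases j <;> simp)

end Example

end Summit.Schanuel.Schanuel.Theorems

end
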